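import Mathlib.Analysis.Calculus.ContDiff.Basic
import Mathlib.Analysis.Calculus.Deriv.Mul
import Mathlib.Analysis.Calculus.Deriv.Comp
import Mathlib.Analysis.Calculus.Deriv.Add
import Mathlib.Analysis.Calculus.IteratedDeriv.Defs
import HarnessLib

/-!
# Second derivatives of bilinear and linear evaluations along curves: `(d∕ds)² B(s)[X(s), Y(s)]`, `(d∕ds)² L(s)[Z(s)]`, `(d∕ds)² c(s)•V(s)`,
# and the instances `B = D²Θ ∘ γ`, `L = DΘ ∘ γ` (Faà di Bruno bookkeeping to order two for evaluated jets; Comtet §3.4)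

Topic `Literature/Analysis/Calculus`; namespace `Literature.Analysis.Calculus`.  THEOREMS ONLY (no `def`, no instance, no notation, no axiom, no named fact, no `sorry`).
Written for cell `pub/hodgecm-mathlib` (ENGINE T1, crux H413 = `stmt-HodgeConjecture-24833`), ROAD A (A4-χ-CHAIN) = work package W5-a of F0P3a-p06 (g12)'s BLUEPRINT «(A4-iii) THE VALUE»
1a660045 §4: the one-sided jets `𝓘_χ′(0⁺)`, `𝓘_χ″(0⁺)` of the transversal sheet integral (★ `UnitBallKCentralTransversalTrace` §4) are integrals of first and second derivatives, along the line
`s ↦ (s, W, |W| + bs)`, of a datum built from EVALUATED JETS `D²Θ(h(s))[X(s), Y(s)]` and `c(s)•DΘ(h(s))[Z(s)]`; this file is the generic calculus that expands such derivatives into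
`D⁴Θ, D³Θ, D²Θ, DΘ` at the base point against the jets of `h, X, Y, Z, c`.  Nothing here is specific to unitary groups; author A-p14 (g29), 2026-09-01.

CURRENCY.  Nested Fréchet derivatives `D^jΘ(x)[a₁][a₂]… := fderiv ℝ (fderiv ℝ (… Θ)) x a₁ a₂ …` (outermost direction first), as in ★ `CurveCompThirdDeriv` and ★ `UnitBallKCentralWallCurveChain` §2; no symmetry of
higher derivatives is used or asserted (a consumer canonicalises slots with Clairaut separately).
* §1 `hasDerivAt_bilinEval` — `(d∕ds) B(s)[X,Y] = B′[X,Y] + B[X′,Y] + B[X,Y′]` (two `HasDerivAt.clm_apply`); **`iteratedDeriv_two_bilinEval`** —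
  `(d∕ds)² B[X,Y] = B″[X,Y] + 2B′[X′,Y] + 2B′[X,Y′] + B[X″,Y] + 2B[X′,Y′] + B[X,Y″]`; `deriv_linEval` ∕ **`iteratedDeriv_two_linEval`** — `(d∕ds)² L[Z] = L″[Z] + 2L′[Z′] + L[Z″]`;
  **`iteratedDeriv_two_smul_eval`** — `(d∕ds)² c•V = c″•V + 2c′•V′ + c•V″`.
* §2 along a curve `γ` through `Θ`: `hasDerivAt_fderiv_fderiv_comp` (`(d∕ds) D²Θ(γ) = D³Θ(γ)[γ′]`, `Θ ∈ C³`), `hasDerivAt_fderiv_fderiv_fderiv_comp_apply` (`(d∕ds) D³Θ(γ)[γ′] = D⁴Θ(γ)[γ′][γ′] + D³Θ(γ)[γ″]`,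
  `Θ ∈ C⁴`), and the HEADS **`iteratedDeriv_two_fderiv_fderiv_comp_apply_apply`** —
  `(d∕ds)²|_{s₀} D²Θ(γ)[X,Y] = D⁴Θ[γ′][γ′][X][Y] + D³Θ[γ″][X][Y] + 2D³Θ[γ′][X′][Y] + 2D³Θ[γ′][X][Y′] + D²Θ[X″][Y] + 2D²Θ[X′][Y′] + D²Θ[X][Y″]` (all at `γ(s₀)`, `Θ ∈ C⁴`),
  **`iteratedDeriv_two_fderiv_comp_apply`** — `(d∕ds)²|_{s₀} DΘ(γ)[Z] = D³Θ[γ′][γ′][Z] + D²Θ[γ″][Z] + 2D²Θ[γ′][Z′] + DΘ[Z″]` (`Θ ∈ C³`), and the first-order companions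
  `deriv_fderiv_fderiv_comp_apply_apply`, `deriv_fderiv_comp_apply`.
HONEST LABEL: elementary calculus; for the cell it pays nothing by itself (HC_CM is proved only modulo the printed citations until rung 0 closes).

## References
* [Comtet1974] L. Comtet, *Advanced Combinatorics* (1974), §3.4 Thm. A (Faà di Bruno; here to order two with product rules).
* [Rudin1980] W. Rudin, *Function Theory in the Unit Ball of ℂⁿ* (1980), §1.4 (calculus of smooth functions of several real variables).
-/

set_option autoImplicit false

noncomputable section

-- the fourth derivative lives in the nested space `E →L[ℝ] E →L[ℝ] E →L[ℝ] E →L[ℝ] G` (cf. ★ `CurveCompThirdDeriv`)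
set_option maxSynthPendingDepth 3

open Set Function Filter
open scoped Topology ContDiff

namespace Literature.Analysis.Calculus

section Eval

variable {E G : Type*} [NormedAddCommGroup E] [NormedSpace ℝ E] [NormedAddCommGroup G] [NormedSpace ℝ G]

/-! ## §1 Bilinear, linear and scalar-weighted evaluations along curves -/

/-- **`(d∕ds) B(s)[X(s), Y(s)] = B′[X,Y] + B[X′,Y] + B[X,Y′]`** for a curve `B` of continuous bilinear maps and two vector curves. [cite: Comtet1974, §3.4 Thm. A] -/
theorem hasDerivAt_bilinEval {B : ℝ → E →L[ℝ] E →L[ℝ] G} {B' : E →L[ℝ] E →L[ℝ] G} {X Y : ℝ → E} {X' Y' : E} {s : ℝ}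
    (hB : HasDerivAt B B' s) (hX : HasDerivAt X X' s) (hY : HasDerivAt Y Y' s) :
    HasDerivAt (fun σ : ℝ => B σ (X σ) (Y σ)) (B' (X s) (Y s) + B s X' (Y s) + B s (X s) Y') s := by
  have h := (hB.clm_apply hX).clm_apply hY
  simpa only [_root_.add_apply, add_assoc] using h

/-- **`(d∕ds)² B(s)[X(s), Y(s)] = B″[X,Y] + 2B′[X′,Y] + 2B′[X,Y′] + B[X″,Y] + 2B[X′,Y′] + B[X,Y″]`** at `s₀` (first derivatives everywhere, second derivatives at `s₀`).
[cite: Comtet1974, §3.4 Thm. A] -/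
theorem iteratedDeriv_two_bilinEval {B B' : ℝ → E →L[ℝ] E →L[ℝ] G} {B''₀ : E →L[ℝ] E →L[ℝ] G} {X X' Y Y' : ℝ → E} {X''₀ Y''₀ : E} {s₀ : ℝ}
    (hB : ∀ σ, HasDerivAt B (B' σ) σ) (hB' : HasDerivAt B' B''₀ s₀) (hX : ∀ σ, HasDerivAt X (X' σ) σ) (hX' : HasDerivAt X' X''₀ s₀)
    (hY : ∀ σ, HasDerivAt Y (Y' σ) σ) (hY' : HasDerivAt Y' Y''₀ s₀) :
    iteratedDeriv 2 (fun σ : ℝ => B σ (X σ) (Y σ)) s₀ =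
      B''₀ (X s₀) (Y s₀) + (2 : ℝ) • B' s₀ (X' s₀) (Y s₀) + (2 : ℝ) • B' s₀ (X s₀) (Y' s₀) +
        B s₀ X''₀ (Y s₀) + (2 : ℝ) • B s₀ (X' s₀) (Y' s₀) + B s₀ (X s₀) Y''₀ := by
  rw [iteratedDeriv_succ, iteratedDeriv_one]
  have hd : deriv (fun σ : ℝ => B σ (X σ) (Y σ)) = fun σ : ℝ => B' σ (X σ) (Y σ) + B σ (X' σ) (Y σ) + B σ (X σ) (Y' σ) :=
    funext fun σ => (hasDerivAt_bilinEval (hB σ) (hX σ) (hY σ)).deriv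
  rw [hd]
  have t1 := hasDerivAt_bilinEval hB' (hX s₀) (hY s₀)
  have t2 := hasDerivAt_bilinEval (hB s₀) hX' (hY s₀)
  have t3 := hasDerivAt_bilinEval (hB s₀) (hX s₀) hY'
  rw [((t1.fun_add t2).fun_add t3).deriv, two_smul, two_smul, two_smul]
  abel

/-- `(d∕ds) L(s)[Z(s)] = L′[Z] + L[Z′]` (Mathlib `HasDerivAt.clm_apply`, recorded in the present currency). [cite: Comtet1974, §3.4 Thm. A] -/
theorem hasDerivAt_linEval {L : ℝ → E →L[ℝ] G} {L' : E →L[ℝ] G} {Z : ℝ → E} {Z' : E} {s : ℝ}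
    (hL : HasDerivAt L L' s) (hZ : HasDerivAt Z Z' s) :
    HasDerivAt (fun σ : ℝ => L σ (Z σ)) (L' (Z s) + L s Z') s :=
  hL.clm_apply hZ

/-- **`(d∕ds)² L(s)[Z(s)] = L″[Z] + 2L′[Z′] + L[Z″]`** at `s₀`. [cite: Comtet1974, §3.4 Thm. A] -/
theorem iteratedDeriv_two_linEval {L L' : ℝ → E →L[ℝ] G} {L''₀ : E →L[ℝ] G} {Z Z' : ℝ → E} {Z''₀ : E} {s₀ : ℝ}
    (hL : ∀ σ, HasDerivAt L (L' σ) σ) (hL' : HasDerivAt L' L''₀ s₀) (hZ : ∀ σ, HasDerivAt Z (Z' σ) σ) (hZ' : HasDerivAt Z' Z''₀ s₀) :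
    iteratedDeriv 2 (fun σ : ℝ => L σ (Z σ)) s₀ = L''₀ (Z s₀) + (2 : ℝ) • L' s₀ (Z' s₀) + L s₀ Z''₀ := by
  rw [iteratedDeriv_succ, iteratedDeriv_one]
  have hd : deriv (fun σ : ℝ => L σ (Z σ)) = fun σ : ℝ => L' σ (Z σ) + L σ (Z' σ) := funext fun σ => (hasDerivAt_linEval (hL σ) (hZ σ)).deriv
  rw [hd]
  have t1 := hasDerivAt_linEval hL' (hZ s₀)
  have t2 := hasDerivAt_linEval (hL s₀) hZ'
  rw [(t1.fun_add t2).deriv, two_smul]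
  abel

/-- **`(d∕ds)² c(s)•V(s) = c″•V + 2c′•V′ + c•V″`** at `s₀` (real scalar weight). [cite: Comtet1974, §3.4 Thm. A] -/
theorem iteratedDeriv_two_smul_eval {c c' : ℝ → ℝ} {c''₀ : ℝ} {V V' : ℝ → G} {V''₀ : G} {s₀ : ℝ}
    (hc : ∀ σ, HasDerivAt c (c' σ) σ) (hc' : HasDerivAt c' c''₀ s₀) (hV : ∀ σ, HasDerivAt V (V' σ) σ) (hV' : HasDerivAt V' V''₀ s₀) :
    iteratedDeriv 2 (fun σ : ℝ => c σ • V σ) s₀ = c''₀ • V s₀ + (2 : ℝ) • c' s₀ • V' s₀ + c s₀ • V''₀ := by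
  rw [iteratedDeriv_succ, iteratedDeriv_one]
  have hd : deriv (fun σ : ℝ => c σ • V σ) = fun σ : ℝ => c σ • V' σ + c' σ • V σ := funext fun σ => ((hc σ).fun_smul (hV σ)).deriv
  rw [hd]
  have t1 := (hc s₀).fun_smul hV'
  have t2 := hc'.fun_smul (hV s₀)
  rw [(t1.fun_add t2).deriv, two_smul]
  abel

end Eval

/-! ## §2 The instances `B = D²Θ ∘ γ`, `L = DΘ ∘ γ` -/

section Jets

variable {E G : Type*} [NormedAddCommGroup E] [NormedSpace ℝ E] [NormedAddCommGroup G] [NormedSpace ℝ G]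

/-- `(d∕ds) DΘ(γ(s)) = D²Θ(γ)[γ′]` for `Θ ∈ C²`. [cite: Rudin1980, §1.4] -/
theorem hasDerivAt_fderiv_comp (Θ : E → G) {n : WithTop ℕ∞} (hΘ : ContDiff ℝ n Θ) (hn : 2 ≤ n) {γ : ℝ → E} {γ'₀ : E} {s : ℝ} (hγ : HasDerivAt γ γ'₀ s) :
    HasDerivAt (fun σ : ℝ => fderiv ℝ Θ (γ σ)) (fderiv ℝ (fderiv ℝ Θ) (γ s) γ'₀) s := by
  -- NB: unascribed (the codomain must keep its operator-norm topology)
  have h1 := hΘ.fderiv_right (m := 1) (by rw [show (1 : WithTop ℕ∞) + 1 = 2 by norm_num]; exact hn)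
  exact (((h1.differentiable (by norm_num)) (γ s)).hasFDerivAt).comp_hasDerivAt s hγ

/-- `(d∕ds) D²Θ(γ(s)) = D³Θ(γ)[γ′]` for `Θ ∈ C³`. [cite: Rudin1980, §1.4] -/
theorem hasDerivAt_fderiv_fderiv_comp (Θ : E → G) {n : WithTop ℕ∞} (hΘ : ContDiff ℝ n Θ) (hn : 3 ≤ n) {γ : ℝ → E} {γ'₀ : E} {s : ℝ} (hγ : HasDerivAt γ γ'₀ s) :
    HasDerivAt (fun σ : ℝ => fderiv ℝ (fderiv ℝ Θ) (γ σ)) (fderiv ℝ (fderiv ℝ (fderiv ℝ Θ)) (γ s) γ'₀) s := by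
  have h2 := hΘ.fderiv_right (m := 2) (by rw [show (2 : WithTop ℕ∞) + 1 = 3 by norm_num]; exact hn)
  exact hasDerivAt_fderiv_comp (fderiv ℝ Θ) h2 le_rfl hγ

/-- `(d∕ds) D³Θ(γ(s))[γ′(s)] = D⁴Θ(γ)[γ′][γ′] + D³Θ(γ)[γ″]` for `Θ ∈ C⁴`. [cite: Rudin1980, §1.4] -/
theorem hasDerivAt_fderiv_fderiv_fderiv_comp_apply (Θ : E → G) {n : WithTop ℕ∞} (hΘ : ContDiff ℝ n Θ) (hn : 4 ≤ n) {γ γ' : ℝ → E} {γ''₀ : E} {s : ℝ}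
    (hγ : HasDerivAt γ (γ' s) s) (hγ' : HasDerivAt γ' γ''₀ s) :
    HasDerivAt (fun σ : ℝ => fderiv ℝ (fderiv ℝ (fderiv ℝ Θ)) (γ σ) (γ' σ))
      (fderiv ℝ (fderiv ℝ (fderiv ℝ (fderiv ℝ Θ))) (γ s) (γ' s) (γ' s) + fderiv ℝ (fderiv ℝ (fderiv ℝ Θ)) (γ s) γ''₀) s := by
  have h3 := hΘ.fderiv_right (m := 3) (by rw [show (3 : WithTop ℕ∞) + 1 = 4 by norm_num]; exact hn)
  have hc := hasDerivAt_fderiv_comp (fderiv ℝ Θ) h3 (by norm_num) hγ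
  -- `hc : (d/ds) D(DΘ)(γ) = D(D(DΘ))(γ)[γ′]`; differentiate once more along `γ′`
  have h2 := h3.fderiv_right (m := 2) (by norm_num)
  have hd := hasDerivAt_fderiv_comp (fderiv ℝ (fderiv ℝ Θ)) h2 le_rfl hγ
  exact hd.clm_apply hγ'

/-- **`(d∕ds)|_{s₀} D²Θ(γ)[X, Y] = D³Θ[γ′][X][Y] + D²Θ[X′][Y] + D²Θ[X][Y′]`** (all at `γ(s₀)`; `Θ ∈ C³`). [cite: Comtet1974, §3.4 Thm. A] [cite: Rudin1980, §1.4] -/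
theorem deriv_fderiv_fderiv_comp_apply_apply (Θ : E → G) {n : WithTop ℕ∞} (hΘ : ContDiff ℝ n Θ) (hn : 3 ≤ n) {γ X Y : ℝ → E} {γ'₀ X'₀ Y'₀ : E} {s₀ : ℝ}
    (hγ : HasDerivAt γ γ'₀ s₀) (hX : HasDerivAt X X'₀ s₀) (hY : HasDerivAt Y Y'₀ s₀) :
    deriv (fun σ : ℝ => fderiv ℝ (fderiv ℝ Θ) (γ σ) (X σ) (Y σ)) s₀ =
      fderiv ℝ (fderiv ℝ (fderiv ℝ Θ)) (γ s₀) γ'₀ (X s₀) (Y s₀) + fderiv ℝ (fderiv ℝ Θ) (γ s₀) X'₀ (Y s₀) + fderiv ℝ (fderiv ℝ Θ) (γ s₀) (X s₀) Y'₀ :=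
  (hasDerivAt_bilinEval (hasDerivAt_fderiv_fderiv_comp Θ hΘ hn hγ) hX hY).deriv

/-- **THE SECOND DERIVATIVE OF AN EVALUATED HESSIAN ALONG A CURVE** (`Θ ∈ C⁴`; first derivatives everywhere, second derivatives at `s₀`; all jets of `Θ` at `γ(s₀)`):
`(d∕ds)²|_{s₀} D²Θ(γ)[X,Y] = D⁴Θ[γ′][γ′][X][Y] + D³Θ[γ″][X][Y] + 2D³Θ[γ′][X′][Y] + 2D³Θ[γ′][X][Y′] + D²Θ[X″][Y] + 2D²Θ[X′][Y′] + D²Θ[X][Y″]`.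
[cite: Comtet1974, §3.4 Thm. A] [cite: Rudin1980, §1.4] -/
theorem iteratedDeriv_two_fderiv_fderiv_comp_apply_apply (Θ : E → G) {n : WithTop ℕ∞} (hΘ : ContDiff ℝ n Θ) (hn : 4 ≤ n) {γ γ' X X' Y Y' : ℝ → E} {γ''₀ X''₀ Y''₀ : E} {s₀ : ℝ}
    (hγ : ∀ σ, HasDerivAt γ (γ' σ) σ) (hγ' : HasDerivAt γ' γ''₀ s₀) (hX : ∀ σ, HasDerivAt X (X' σ) σ) (hX' : HasDerivAt X' X''₀ s₀)
    (hY : ∀ σ, HasDerivAt Y (Y' σ) σ) (hY' : HasDerivAt Y' Y''₀ s₀) :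
    iteratedDeriv 2 (fun σ : ℝ => fderiv ℝ (fderiv ℝ Θ) (γ σ) (X σ) (Y σ)) s₀ =
      fderiv ℝ (fderiv ℝ (fderiv ℝ (fderiv ℝ Θ))) (γ s₀) (γ' s₀) (γ' s₀) (X s₀) (Y s₀) + fderiv ℝ (fderiv ℝ (fderiv ℝ Θ)) (γ s₀) γ''₀ (X s₀) (Y s₀) +
        (2 : ℝ) • fderiv ℝ (fderiv ℝ (fderiv ℝ Θ)) (γ s₀) (γ' s₀) (X' s₀) (Y s₀) + (2 : ℝ) • fderiv ℝ (fderiv ℝ (fderiv ℝ Θ)) (γ s₀) (γ' s₀) (X s₀) (Y' s₀) +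
        fderiv ℝ (fderiv ℝ Θ) (γ s₀) X''₀ (Y s₀) + (2 : ℝ) • fderiv ℝ (fderiv ℝ Θ) (γ s₀) (X' s₀) (Y' s₀) + fderiv ℝ (fderiv ℝ Θ) (γ s₀) (X s₀) Y''₀ := by
  have h3 : (3 : WithTop ℕ∞) ≤ n := le_trans (by norm_num) hn
  have hB : ∀ σ, HasDerivAt (fun σ : ℝ => fderiv ℝ (fderiv ℝ Θ) (γ σ)) (fderiv ℝ (fderiv ℝ (fderiv ℝ Θ)) (γ σ) (γ' σ)) σ :=
    fun σ => hasDerivAt_fderiv_fderiv_comp Θ hΘ h3 (hγ σ)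
  have hB' := hasDerivAt_fderiv_fderiv_fderiv_comp_apply Θ hΘ hn (hγ s₀) hγ'
  rw [iteratedDeriv_two_bilinEval hB hB' hX hX' hY hY', _root_.add_apply, _root_.add_apply]

/-- `(d∕ds)|_{s₀} DΘ(γ)[Z] = D²Θ[γ′][Z] + DΘ[Z′]` (`Θ ∈ C²`). [cite: Comtet1974, §3.4 Thm. A] [cite: Rudin1980, §1.4] -/
theorem deriv_fderiv_comp_apply (Θ : E → G) {n : WithTop ℕ∞} (hΘ : ContDiff ℝ n Θ) (hn : 2 ≤ n) {γ Z : ℝ → E} {γ'₀ Z'₀ : E} {s₀ : ℝ}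
    (hγ : HasDerivAt γ γ'₀ s₀) (hZ : HasDerivAt Z Z'₀ s₀) :
    deriv (fun σ : ℝ => fderiv ℝ Θ (γ σ) (Z σ)) s₀ = fderiv ℝ (fderiv ℝ Θ) (γ s₀) γ'₀ (Z s₀) + fderiv ℝ Θ (γ s₀) Z'₀ :=
  (hasDerivAt_linEval (hasDerivAt_fderiv_comp Θ hΘ hn hγ) hZ).deriv

/-- **THE SECOND DERIVATIVE OF AN EVALUATED GRADIENT ALONG A CURVE** (`Θ ∈ C³`):
`(d∕ds)²|_{s₀} DΘ(γ)[Z] = D³Θ[γ′][γ′][Z] + D²Θ[γ″][Z] + 2D²Θ[γ′][Z′] + DΘ[Z″]`. [cite: Comtet1974, §3.4 Thm. A] [cite: Rudin1980, §1.4] -/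
theorem iteratedDeriv_two_fderiv_comp_apply (Θ : E → G) {n : WithTop ℕ∞} (hΘ : ContDiff ℝ n Θ) (hn : 3 ≤ n) {γ γ' Z Z' : ℝ → E} {γ''₀ Z''₀ : E} {s₀ : ℝ}
    (hγ : ∀ σ, HasDerivAt γ (γ' σ) σ) (hγ' : HasDerivAt γ' γ''₀ s₀) (hZ : ∀ σ, HasDerivAt Z (Z' σ) σ) (hZ' : HasDerivAt Z' Z''₀ s₀) :
    iteratedDeriv 2 (fun σ : ℝ => fderiv ℝ Θ (γ σ) (Z σ)) s₀ =
      fderiv ℝ (fderiv ℝ (fderiv ℝ Θ)) (γ s₀) (γ' s₀) (γ' s₀) (Z s₀) + fderiv ℝ (fderiv ℝ Θ) (γ s₀) γ''₀ (Z s₀) +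
        (2 : ℝ) • fderiv ℝ (fderiv ℝ Θ) (γ s₀) (γ' s₀) (Z' s₀) + fderiv ℝ Θ (γ s₀) Z''₀ := by
  have h2 : (2 : WithTop ℕ∞) ≤ n := le_trans (by norm_num) hn
  have hL : ∀ σ, HasDerivAt (fun σ : ℝ => fderiv ℝ Θ (γ σ)) (fderiv ℝ (fderiv ℝ Θ) (γ σ) (γ' σ)) σ := fun σ => hasDerivAt_fderiv_comp Θ hΘ h2 (hγ σ)
  -- `(d/ds) D²Θ(γ)[γ′] = D³Θ(γ)[γ′][γ′] + D²Θ(γ)[γ″]`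
  have h2' := hΘ.fderiv_right (m := 2) (by rw [show (2 : WithTop ℕ∞) + 1 = 3 by norm_num]; exact hn)
  have hL' : HasDerivAt (fun σ : ℝ => fderiv ℝ (fderiv ℝ Θ) (γ σ) (γ' σ))
      (fderiv ℝ (fderiv ℝ (fderiv ℝ Θ)) (γ s₀) (γ' s₀) (γ' s₀) + fderiv ℝ (fderiv ℝ Θ) (γ s₀) γ''₀) s₀ :=
    (hasDerivAt_fderiv_comp (fderiv ℝ Θ) h2' le_rfl (hγ s₀)).clm_apply hγ'
  rw [iteratedDeriv_two_linEval hL hL' hZ hZ', _root_.add_apply]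

end Jets

end Literature.Analysis.Calculus

end
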